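import Summits.CriticalPhenomena.CardyFormulaZ2.Theorems.CardyUniqueLimitCardyRigidityConformalKit
import Literature.Probability.RandomPlanarGeometry.CaratheodoryLC
import HarnessLib

/-!
# Conformal kit (K2): uniform local connectedness ⇒ uniform boundary modulus of continuity of a
conformal map of the half-plane

Crux `Summit.CriticalPhenomena.CardyFormulaZ2.Theses.CardyUniqueLimit.CardyRigidity`
(stmt-CriticalPhenomena-0746), line `crossing_martingale`, helper kit for the heart
`stub_slitObservableApprox`.  The single-map, quantitative, HALF-PLANE form of Pommerenke's
Proposition 2.3 (*Boundary Behaviour of Conformal Maps* (1992), §2.2; the tree's disc form is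
`ConformalEquiv.dist_lt_of_crosscut_data` in `RadoConvergenceProofs.lean`, its Jordan-curve
equicontinuity form `JordanDomain.eventually_equicontinuous_of_hlc` in `KernelConvergenceULC.lean`):

Let `f : ℍ → U` be a conformal bijection onto an open `U ⊆ ℂ` with continuous inverse
`g : U → ℍ`, moving points by at most `C₀` (`‖f w - w‖ ≤ C₀`; the inverse Loewner maps
`f_t = g_t⁻¹ : ℍ → ℍ ∖ K_t`, Lawler (2005) (3.12)).  Suppose `ℂ ∖ U` is uniformly locally connected
at scale `(ε₁, η)` near a real point `x`: any two points of `∂U` in the disc `B̄(x, 1 + C₀)` at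
distance `< ε₁` lie in a compact connected subset of `ℂ ∖ U` inside the closed `η`-disc about the
first (hypothesis `hlc`, the formulation of the tree's `CaratheodoryLC` / `KernelConvergenceULC`
files, localised to a set `V ⊇ B̄(x, 1 + C₀)`).  If `0 < d < 1` is so small that the Wolff bound
`4π (1 + C₀)/√(log (1/d))` is `< ε₁` and `≤ η`, then

  **`f(ℍ ∩ B(x, d)) ⊆ B̄(a, η)` for a point `a ∈ ∂U`**    (`exists_forall_dist_le_of_hlc`),

so `f` oscillates by at most `2η` on `ℍ ∩ B(x, d)`; the scale `d` depends only on `C₀`, `ε₁`,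
`η` (sequel file `…ConformalKit3.lean`: `dist_le_of_hlc`, `exists_scale_lt_le`, and the
uniform-continuity form on `ℍ ∩ B̄(0, X)`).  Proof (Pommerenke p. 21–22): by (K1a)
(`ConformalKit.exists_radius_short_image_of_displacement`) some semicircle `{|w - x| = ρ} ∩ ℍ`,
`d < ρ < √d`, has an `f`-image (a crosscut of `U`) of length `≤ 4π (1 + C₀)/√(log (1/d))`, with
endpoints `a, b ∈ ∂U` (`exists_crosscut_halfPlane`); `hlc` joins `a` to `b` by a small continuum
`σ ⊆ ℂ ∖ U`; and the near side `f(ℍ ∩ B(x, ρ))` lies in the `η`-disc about `a` by Janiszewski's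
theorem (`forall_dist_le_of_crosscut_halfPlane`: a far point `f(x + iH)` and a point of the near
side outside that disc would be separated neither by `A = C̄ ∪ σ` nor by
`B = ((ℂ ∖ U) ∩ B̄(a, R₂)) ∪ ∂B(a, R₂)`, hence joined by a connected set inside `U ∖ C`, whose
`g`-image joins the inside of the semicircle to its outside within `ℍ` without meeting it).

References: Ch. Pommerenke (1992), §1.1 (Janiszewski), Prop. 2.2, Prop. 2.3, Cor. 2.4
[PommerenkeBBCM1992]; G. F. Lawler (2005), §3.4 (3.12) [Lawler2005].
-/

noncomputable section

open Set Filter Metric MeasureTheory Real Bornology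
open _root_.Complex _root_.Topology
open UpperHalfPlane (upperHalfPlaneSet isOpen_upperHalfPlaneSet)
open scoped ENNReal NNReal
open Literature.Analysis.Complex.LengthArea

namespace Summit.CriticalPhenomena.CardyFormulaZ2.Cruxes.CardyRigidity.CrossingMartingale

namespace ConformalKit

variable {U : Set ℂ} {f g : ℂ → ℂ}

/-! ### Semicircles about a real centre and boundary limits -/

/-- For `r > 0` and `t ∈ (0, π)` the point `x + re^{it}` of the circle about the real centre `x`
lies in the open upper half-plane. [folklore] -/
theorem circleMap_mem_upperHalfPlaneSet (x : ℝ) {r t : ℝ} (hr : 0 < r) (ht : t ∈ Ioo 0 π) :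
    circleMap (x : ℂ) r t ∈ upperHalfPlaneSet := by
  show 0 < (circleMap (x : ℂ) r t).im
  have him : (circleMap (x : ℂ) r t).im = r * Real.sin t := by
    simp [circleMap, Complex.exp_ofReal_mul_I_im, Complex.exp_ofReal_mul_I_re]
  rw [him]
  exact mul_pos hr (Real.sin_pos_of_pos_of_lt_pi ht.1 ht.2)

/-- A point of the open upper half-plane at distance `r > 0` from the real point `x` is
`x + re^{it}` for some `t ∈ (0, π)`. [folklore] -/
theorem exists_mem_Ioo_eq_circleMap (x : ℝ) {r : ℝ} (hr : 0 < r) {z : ℂ}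
    (hz : z ∈ upperHalfPlaneSet) (hzr : dist z x = r) :
    ∃ t ∈ Ioo 0 π, z = circleMap (x : ℂ) r t := by
  have hzr' : ‖z - (x : ℂ)‖ = r := by rwa [← dist_eq_norm]
  obtain ⟨t, ht, hzt⟩ := exists_eq_circleMap_of_norm_sub (x : ℂ) hzr'
  have h0 : (0 : ℝ) < (circleMap (x : ℂ) r t).im := by rw [← hzt]; exact hz
  have him : (circleMap (x : ℂ) r t).im = r * Real.sin t := by
    simp [circleMap, Complex.exp_ofReal_mul_I_im, Complex.exp_ofReal_mul_I_re]
  rw [him] at h0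
  refine ⟨t, ⟨?_, lt_of_le_of_ne ht.2 fun h ↦ ?_⟩, hzt⟩
  · by_contra hle
    push Not at hle
    have hsin : Real.sin t ≤ 0 := Real.sin_nonpos_of_nonpos_of_neg_pi_le hle ht.1.le
    nlinarith
  · rw [h, Real.sin_pi, mul_zero] at h0
    exact lt_irrefl _ h0

/-- **Boundary limits of `f` are boundary points of `U`.** If `zᵢ ∈ ℍ` tend to a point `z₀ ∉ ℍ`
and `f zᵢ → a`, then `a ∈ ∂U` (`a ∈ U` would give `zᵢ = g (f zᵢ) → g a ∈ ℍ` by continuity of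
the inverse). [folklore] -/
theorem mem_frontier_of_tendsto (hU : IsOpen U) (hfU : MapsTo f upperHalfPlaneSet U)
    (hgc : ContinuousOn g U) (hgU : MapsTo g U upperHalfPlaneSet)
    (hgf : ∀ w ∈ upperHalfPlaneSet, g (f w) = w) {ι : Type*} {l : Filter ι} [NeBot l]
    {z : ι → ℂ} (hz : ∀ᶠ i in l, z i ∈ upperHalfPlaneSet) {z₀ : ℂ} (hz₀ : z₀ ∉ upperHalfPlaneSet)
    (hzz₀ : Tendsto z l (𝓝 z₀)) {a : ℂ} (ha : Tendsto (fun i ↦ f (z i)) l (𝓝 a)) :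
    a ∈ frontier U := by
  have hcl : a ∈ closure U := mem_closure_of_tendsto ha (hz.mono fun i hi ↦ hfU hi)
  rw [frontier, hU.interior_eq]
  refine ⟨hcl, fun haU ↦ hz₀ ?_⟩
  have hlim : Tendsto (fun i ↦ g (f (z i))) l (𝓝 (g a)) :=
    ((hgc a haU).continuousAt (hU.mem_nhds haU)).tendsto.comp ha
  have hlim' : Tendsto z l (𝓝 (g a)) :=
    hlim.congr' (hz.mono fun i hi ↦ hgf _ hi)
  rw [tendsto_nhds_unique hzz₀ hlim']
  exact hgU haU

/-- **A short semicircular crosscut.** Let `f : ℍ → U` be holomorphic with continuous inverse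
`g : U → ℍ` (`U` open), `x` real, `r > 0`, and suppose the `f`-image of the semicircle
`{|w - x| = r} ∩ ℍ` has length `r Λ_ℍ(r) ≤ L`.  Then the crosscut `t ↦ f(x + re^{it})`,
`t ∈ (0, π)`, has endpoints `a` (at `0⁺`) and `b` (at `π⁻`) on `∂U`, stays within `L` of `a`,
and `dist a b ≤ L`. [cite: PommerenkeBBCM1992, Prop. 2.2] -/
theorem exists_crosscut_halfPlane (hf : DifferentiableOn ℂ f upperHalfPlaneSet) (hU : IsOpen U)
    (hfU : MapsTo f upperHalfPlaneSet U) (hgc : ContinuousOn g U)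
    (hgU : MapsTo g U upperHalfPlaneSet) (hgf : ∀ w ∈ upperHalfPlaneSet, g (f w) = w)
    {x r L : ℝ} (hr : 0 < r) (hL : 0 ≤ L)
    (hlen : ENNReal.ofReal r * angLenAt upperHalfPlaneSet f x r ≤ ENNReal.ofReal L) :
    ∃ a b : ℂ, a ∈ frontier U ∧ b ∈ frontier U ∧
      Tendsto (fun t ↦ f (circleMap (x : ℂ) r t)) (𝓝[>] 0) (𝓝 a) ∧
      Tendsto (fun t ↦ f (circleMap (x : ℂ) r t)) (𝓝[<] π) (𝓝 b) ∧
      (∀ t ∈ Ioo 0 π, dist (f (circleMap (x : ℂ) r t)) a ≤ L) ∧ dist a b ≤ L := by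
  have harc : ∀ t ∈ Ioo 0 π, circleMap (x : ℂ) r t ∈ upperHalfPlaneSet :=
    fun t ht ↦ circleMap_mem_upperHalfPlaneSet x hr ht
  obtain ⟨a, b, ha, hb, hda, -, hab⟩ := exists_endpoints_of_arc isOpen_upperHalfPlaneSet hf hr hL
    hlen (θ₁ := 0) (θ₂ := π) ⟨by linarith [pi_pos], pi_pos.le⟩ pi_pos (by linarith [pi_pos]) harc
  have hev1 : ∀ᶠ t in 𝓝[>] (0 : ℝ), circleMap (x : ℂ) r t ∈ upperHalfPlaneSet := by
    filter_upwards [Ioo_mem_nhdsGT pi_pos] with t ht using harc t ht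
  have hev2 : ∀ᶠ t in 𝓝[<] π, circleMap (x : ℂ) r t ∈ upperHalfPlaneSet := by
    filter_upwards [Ioo_mem_nhdsLT pi_pos] with t ht using harc t ht
  have hreal : ∀ t : ℝ, Real.sin t = 0 → circleMap (x : ℂ) r t ∉ upperHalfPlaneSet := by
    intro t ht hmem
    have h0 : (0 : ℝ) < (circleMap (x : ℂ) r t).im := hmem
    simp [circleMap, Complex.exp_ofReal_mul_I_im, Complex.exp_ofReal_mul_I_re, ht] at h0
  have hc : Continuous fun t : ℝ ↦ circleMap (x : ℂ) r t := continuous_circleMap _ _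
  refine ⟨a, b, ?_, ?_, ha, hb, hda, hab⟩
  · exact mem_frontier_of_tendsto hU hfU hgc hgU hgf hev1 (hreal 0 Real.sin_zero)
      ((hc.tendsto 0).mono_left nhdsWithin_le_nhds) ha
  · exact mem_frontier_of_tendsto hU hfU hgc hgU hgf hev2 (hreal π Real.sin_pi)
      ((hc.tendsto π).mono_left nhdsWithin_le_nhds) hb

/-! ### The near side of a short crosscut is small (Janiszewski) -/

/-- **The near side of a short semicircular crosscut is small** (half-plane form of the tree's
`ConformalEquiv.image_inter_ball_subset_of_subset_compl`, via Janiszewski's theorem).  Let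
`f : ℍ → U` be continuous with continuous inverse `g : U → ℍ` (`U` open), `C` the crosscut
`t ↦ f(x + re^{it})`, `t ∈ (0, π)`, with endpoints `a, b`, and `σ ⊆ ℂ ∖ U` a compact
preconnected set containing `a, b`; suppose `C` and `σ` lie in `B̄(a, R)`, that some `z₀ ∈ ℍ`
with `|z₀ - x| > r` has `dist (f z₀) a > R`, and that `f(ℍ ∩ B(x, R₃))` is bounded for some
`R₃ > |z₀ - x|`.  Then `f` maps `ℍ ∩ B(x, r)` into `B̄(a, R)`. [cite: PommerenkeBBCM1992, Thm. 2.1] -/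
theorem forall_dist_le_of_crosscut_halfPlane (hfc : ContinuousOn f upperHalfPlaneSet)
    (hU : IsOpen U) (hfU : MapsTo f upperHalfPlaneSet U) (hgc : ContinuousOn g U)
    (hgU : MapsTo g U upperHalfPlaneSet) (hgf : ∀ w ∈ upperHalfPlaneSet, g (f w) = w)
    (hfg : ∀ z ∈ U, f (g z) = z) {x r : ℝ} (hr : 0 < r) {a b : ℂ}
    (ha : Tendsto (fun t ↦ f (circleMap (x : ℂ) r t)) (𝓝[>] 0) (𝓝 a))
    (hb : Tendsto (fun t ↦ f (circleMap (x : ℂ) r t)) (𝓝[<] π) (𝓝 b))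
    {σ : Set ℂ} (hσc : IsPreconnected σ) (hσK : IsCompact σ) (hσU : σ ⊆ Uᶜ) (haσ : a ∈ σ)
    (hbσ : b ∈ σ) {R : ℝ} (hRc : ∀ t ∈ Ioo 0 π, dist (f (circleMap (x : ℂ) r t)) a ≤ R)
    (hRσ : σ ⊆ closedBall a R) {z₀ : ℂ} (hz₀ : z₀ ∈ upperHalfPlaneSet) (hz₀r : r < dist z₀ x)
    (hfar : R < dist (f z₀) a) {R₃ : ℝ} (hR₃ : dist z₀ x < R₃)
    (hbdd : IsBounded (f '' (upperHalfPlaneSet ∩ ball (x : ℂ) R₃))) :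
    ∀ w ∈ upperHalfPlaneSet, dist w x < r → dist (f w) a ≤ R := by
  have hR0 : 0 ≤ R := dist_nonneg.trans (hRσ hbσ)
  have harc : ∀ t ∈ Ioo 0 π, circleMap (x : ℂ) r t ∈ upperHalfPlaneSet :=
    fun t ht ↦ circleMap_mem_upperHalfPlaneSet x hr ht
  set c : ℝ → ℂ := fun t ↦ f (circleMap (x : ℂ) r t) with hc
  set C : Set ℂ := c '' Ioo 0 π with hCdef
  have hCU : C ⊆ U := by
    rintro _ ⟨t, ht, rfl⟩
    exact hfU (harc t ht)
  have hCR : C ⊆ closedBall a R := by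
    rintro _ ⟨t, ht, rfl⟩
    exact mem_closedBall.2 (hRc t ht)
  -- the closed crosscut `C̄ = C ∪ {a, b}` as a continuous image of `[0, π]`
  have hcc : ContinuousOn c (Ioo 0 π) :=
    hfc.comp (continuous_circleMap _ _).continuousOn harc
  set cbar : ℝ → ℂ := extendFrom (Ioo 0 π) c with hcbar
  have hcbar_c : ContinuousOn cbar (Icc 0 π) := continuousOn_Icc_extendFrom_Ioo hcc ha hb
  have hcbar_a : cbar 0 = a := eq_lim_at_left_extendFrom_Ioo pi_pos ha
  have hcbar_b : cbar π = b := eq_lim_at_right_extendFrom_Ioo pi_pos hb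
  have hcbar_eq : ∀ t ∈ Ioo 0 π, cbar t = c t := fun t ht ↦ extendFrom_extends hcc t ht
  set Cbar : Set ℂ := cbar '' Icc 0 π with hCbar
  have hCbarK : IsCompact Cbar := isCompact_Icc.image_of_continuousOn hcbar_c
  have hCbar_sub : Cbar ⊆ C ∪ {a, b} := by
    rintro _ ⟨t, ht, rfl⟩
    rcases eq_or_lt_of_le ht.1 with h1 | h1
    · exact Or.inr (Or.inl (by rw [← h1, hcbar_a]))
    rcases eq_or_lt_of_le ht.2 with h2 | h2
    · exact Or.inr (Or.inr (by rw [h2, hcbar_b]; exact mem_singleton b))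
    · exact Or.inl ⟨t, ⟨h1, h2⟩, (hcbar_eq t ⟨h1, h2⟩).symm⟩
  have hC_sub : C ⊆ Cbar := by
    rintro _ ⟨t, ht, rfl⟩
    exact ⟨t, Ioo_subset_Icc_self ht, hcbar_eq t ht⟩
  -- the two compact sets of Janiszewski's theorem
  set A : Set ℂ := Cbar ∪ σ with hA
  have hAK : IsCompact A := hCbarK.union hσK
  have hAR : A ⊆ closedBall a R := by
    refine union_subset (hCbar_sub.trans (union_subset hCR ?_)) hRσ
    rintro z (rfl | rfl)
    · exact mem_closedBall_self hR0
    · exact hRσ hbσ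
  obtain ⟨M, hM⟩ := hbdd.subset_closedBall a
  set R₂ : ℝ := max M R + 1 with hR₂
  have hRR₂ : R < R₂ := by rw [hR₂]; linarith [le_max_right M R]
  have hMR₂ : M < R₂ := by rw [hR₂]; linarith [le_max_left M R]
  set B : Set ℂ := (Uᶜ ∩ closedBall a R₂) ∪ sphere a R₂ with hB
  have hBK : IsCompact B :=
    ((isCompact_closedBall a R₂).inter_left hU.isClosed_compl).union (isCompact_sphere a R₂)
  have hAB : A ∩ B = σ := by
    refine Subset.antisymm ?_ fun z hz ↦
      ⟨Or.inr hz, Or.inl ⟨hσU hz, closedBall_subset_closedBall hRR₂.le (hRσ hz)⟩⟩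
    rintro z ⟨hzA, hzB⟩
    have hzR : dist z a ≤ R := mem_closedBall.1 (hAR hzA)
    rcases hzB with ⟨hzU, -⟩ | hzS
    · rcases hzA with hzC | hzσ
      · rcases hCbar_sub hzC with hzC' | (rfl | rfl)
        · exact absurd (hCU hzC') hzU
        · exact haσ
        · exact hbσ
      · exact hzσ
    · rw [mem_sphere] at hzS
      linarith
  -- the far point and the near side
  have hz₀U : f z₀ ∈ U := hfU hz₀
  have hS' : f '' (upperHalfPlaneSet ∩ ball (x : ℂ) R₃) ⊆ U ∩ ball a R₂ := by
    rintro _ ⟨w, ⟨hw, hwx⟩, rfl⟩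
    exact ⟨hfU hw, mem_ball.2 ((mem_closedBall.1 (hM ⟨w, ⟨hw, hwx⟩, rfl⟩)).trans_lt hMR₂)⟩
  intro w hw hwr
  by_contra hwR
  rw [not_le] at hwR
  have hwU : f w ∈ U := hfU hw
  have hwR₃ : w ∈ upperHalfPlaneSet ∩ ball (x : ℂ) R₃ :=
    ⟨hw, mem_ball.2 (hwr.trans (hz₀r.trans hR₃))⟩
  have hz₀R₃ : z₀ ∈ upperHalfPlaneSet ∩ ball (x : ℂ) R₃ := ⟨hz₀, mem_ball.2 hR₃⟩
  -- neither `A` nor `B` separates `f z₀` from `f w`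
  have hSA : ∃ S ⊆ Aᶜ, IsPreconnected S ∧ f z₀ ∈ S ∧ f w ∈ S :=
    ⟨{z | R < dist z a}, fun z hz hzA ↦ (not_le.2 hz) (mem_closedBall.1 (hAR hzA)),
      Literature.Probability.RandomPlanarGeometry.isPreconnected_setOf_lt_dist a hR0, hfar, hwR⟩
  have hSB : ∃ S ⊆ Bᶜ, IsPreconnected S ∧ f z₀ ∈ S ∧ f w ∈ S := by
    refine ⟨f '' (upperHalfPlaneSet ∩ ball (x : ℂ) R₃), fun z hz hzB ↦ ?_,
      (((convex_halfSpace_im_gt 0).inter (convex_ball _ _)).isPreconnected).image _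
        (hfc.mono inter_subset_left), ⟨z₀, hz₀R₃, rfl⟩, ⟨w, hwR₃, rfl⟩⟩
    obtain ⟨hzU, hzball⟩ := hS' hz
    rcases hzB with ⟨hzU', -⟩ | hzS
    · exact hzU' hzU
    · rw [mem_sphere] at hzS
      rw [mem_ball] at hzball
      linarith
  obtain ⟨V, hV, hVc, h0V, hwV⟩ :=
    Literature.Topology.PlaneTopology.janiszewski' hAK hBK (hAB ▸ hσc) hSA hSB
  -- `V ⊆ U ∖ C`
  have hVU : V ⊆ U := by
    have hcov : V ⊆ (U ∩ ball a R₂) ∪ (closedBall a R₂)ᶜ := by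
      intro z hz
      by_cases hzb : z ∈ closedBall a R₂
      · refine Or.inl ⟨?_, ?_⟩
        · by_contra hzU
          exact hV hz (Or.inr (Or.inl ⟨hzU, hzb⟩))
        · refine mem_ball.2 (lt_of_le_of_ne (mem_closedBall.1 hzb) fun heq ↦ ?_)
          exact hV hz (Or.inr (Or.inr (mem_sphere.2 heq)))
      · exact Or.inr hzb
    have hsub := hVc.subset_left_of_subset_union (hU.inter isOpen_ball)
      isClosed_closedBall.isOpen_compl ?_ hcov ⟨f w, hwV, hS' ⟨w, hwR₃, rfl⟩⟩
    · exact hsub.trans inter_subset_left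
    · exact Set.disjoint_left.2 fun z hz hz' ↦ hz' (ball_subset_closedBall hz.2)
  have hVC : ∀ z ∈ V, z ∉ C := fun z hz hzC ↦ hV hz (Or.inl (Or.inl (hC_sub hzC)))
  -- pull back to `ℍ` and apply the intermediate value theorem to `dist · x`
  set V' : Set ℂ := g '' V with hV'
  have hV'c : IsPreconnected V' := hVc.image _ (hgc.mono hVU)
  have h0V' : z₀ ∈ V' := ⟨f z₀, h0V, hgf z₀ hz₀⟩
  have hwV' : w ∈ V' := ⟨f w, hwV, hgf w hw⟩
  have hdc : ContinuousOn (fun z : ℂ ↦ dist z x) V' := by fun_prop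
  obtain ⟨u, huV', hur⟩ : ∃ u ∈ V', dist u (x : ℂ) = r :=
    hV'c.intermediate_value hwV' h0V' hdc ⟨hwr.le, hz₀r.le⟩
  obtain ⟨v, hvV, rfl⟩ := huV'
  have hvU : v ∈ U := hVU hvV
  have hgvH : g v ∈ upperHalfPlaneSet := hgU hvU
  obtain ⟨t, ht, hgt⟩ := exists_mem_Ioo_eq_circleMap x hr hgvH hur
  have hmemC : f (g v) ∈ C := ⟨t, ht, by change f (circleMap (x : ℂ) r t) = f (g v); rw [hgt]⟩
  rw [hfg v hvU] at hmemC
  exact hVC v hvV hmemC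

/-! ### (K2) Uniform local connectedness ⇒ uniform boundary modulus -/

section Modulus

variable {C₀ : ℝ} {V : Set ℂ} {ε₁ η : ℝ}

/-- **(K2) Uniform local connectedness of `ℂ ∖ U` near `x` ⇒ the near side `f(ℍ ∩ B(x, d))` is
small.**  Let `f : ℍ → U` be a conformal bijection onto the open set `U` with continuous inverse
`g`, `‖f w - w‖ ≤ C₀` on `ℍ`; let `hlc` be the uniform local connectedness of `ℂ ∖ U` at scale
`(ε₁, η)` for boundary points in a set `V ⊇ B̄(x, 1 + C₀)` (`x` real); and let `0 < d < 1` with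
`4π (1 + C₀)/√(log (1/d)) < ε₁` and `≤ η`.  Then `f(ℍ ∩ B(x, d)) ⊆ B̄(a, η)` for some `a ∈ ∂U`.
Pommerenke (1992), Prop. 2.3 (proof of Thm. 2.1 (iv) ⇒ (i)), in the half-plane, with the data
made explicit: the radius `d` depends only on `C₀`, `ε₁`, `η`. [cite: PommerenkeBBCM1992, Prop. 2.3] -/
theorem exists_forall_dist_le_of_hlc (hf : DifferentiableOn ℂ f upperHalfPlaneSet)
    (hU : IsOpen U) (hfU : MapsTo f upperHalfPlaneSet U) (hgc : ContinuousOn g U)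
    (hgU : MapsTo g U upperHalfPlaneSet) (hgf : ∀ w ∈ upperHalfPlaneSet, g (f w) = w)
    (hfg : ∀ z ∈ U, f (g z) = z) (hC₀ : 0 ≤ C₀) (hC : ∀ w ∈ upperHalfPlaneSet, ‖f w - w‖ ≤ C₀)
    (hlc : ∀ a ∈ frontier U, ∀ b ∈ frontier U, a ∈ V → b ∈ V → dist a b < ε₁ →
      ∃ σ ⊆ Uᶜ, IsCompact σ ∧ IsPreconnected σ ∧ a ∈ σ ∧ b ∈ σ ∧ σ ⊆ closedBall a η)
    {d : ℝ} (hd : 0 < d) (hd1 : d < 1) (hε₁ : 4 * π * (1 + C₀) / √(Real.log (1 / d)) < ε₁)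
    (hη : 4 * π * (1 + C₀) / √(Real.log (1 / d)) ≤ η) {x : ℝ}
    (hV : closedBall (x : ℂ) (1 + C₀) ⊆ V) :
    ∃ a ∈ frontier U, ∀ w ∈ upperHalfPlaneSet, dist w x < d → dist (f w) a ≤ η := by
  set L : ℝ := 4 * π * (1 + C₀) / √(Real.log (1 / d)) with hLdef
  have hL : 0 ≤ L := by positivity
  have hinj : InjOn f upperHalfPlaneSet := fun w hw w' hw' h ↦ by
    rw [← hgf w hw, ← hgf w' hw', h]
  -- (K1a): a semicircle about `x` of radius `ρ ∈ (d, √d)` with short image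
  obtain ⟨ρ, ⟨hdρ, hρd⟩, hlen⟩ := exists_radius_short_image_of_displacement (p := (x : ℂ))
    isOpen_upperHalfPlaneSet hf hinj hC₀ hC hd hd1
  have hρ0 : 0 < ρ := hd.trans hdρ
  have hρ1 : ρ < 1 := hρd.trans ((Real.sqrt_lt' one_pos).2 (by simpa using hd1))
  obtain ⟨a, b, haU, hbU, ha, hb, hda, hab⟩ :=
    exists_crosscut_halfPlane hf hU hfU hgc hgU hgf hρ0 hL hlen
  -- the endpoints lie in `B̄(x, 1 + C₀) ⊆ V`
  have harc : ∀ t ∈ Ioo 0 π, circleMap (x : ℂ) ρ t ∈ upperHalfPlaneSet :=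
    fun t ht ↦ circleMap_mem_upperHalfPlaneSet x hρ0 ht
  have hnear : ∀ t ∈ Ioo 0 π, f (circleMap (x : ℂ) ρ t) ∈ closedBall (x : ℂ) (1 + C₀) := by
    intro t ht
    rw [mem_closedBall, dist_eq_norm]
    have h1 := hC _ (harc t ht)
    have h2 : ‖circleMap (x : ℂ) ρ t - x‖ = ρ := by
      rw [circleMap_sub_center, norm_circleMap_zero, abs_of_pos hρ0]
    calc ‖f (circleMap (x : ℂ) ρ t) - x‖
        = ‖(f (circleMap (x : ℂ) ρ t) - circleMap (x : ℂ) ρ t) + (circleMap (x : ℂ) ρ t - x)‖ := by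
          ring_nf
      _ ≤ ‖f (circleMap (x : ℂ) ρ t) - circleMap (x : ℂ) ρ t‖ + ‖circleMap (x : ℂ) ρ t - x‖ :=
          norm_add_le _ _
      _ ≤ C₀ + ρ := add_le_add h1 h2.le
      _ ≤ 1 + C₀ := by linarith
  have haV : a ∈ V := hV (isClosed_closedBall.mem_of_tendsto ha
    (by filter_upwards [Ioo_mem_nhdsGT pi_pos] with t ht using hnear t ht))
  have hbV : b ∈ V := hV (isClosed_closedBall.mem_of_tendsto hb
    (by filter_upwards [Ioo_mem_nhdsLT pi_pos] with t ht using hnear t ht))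
  -- the small continuum joining the endpoints
  obtain ⟨σ, hσU, hσK, hσc, haσ, hbσ, hση⟩ := hlc a haU b hbU haV hbV (hab.trans_lt hε₁)
  -- the far point `z₀ = x + iH`
  set H : ℝ := η + 2 * C₀ + 3 with hH
  have hη0 : 0 ≤ η := hL.trans hη
  have hH0 : 0 < H := by positivity
  set z₀ : ℂ := (x : ℂ) + H * I with hz₀
  have hz₀H : z₀ ∈ upperHalfPlaneSet := by
    show 0 < z₀.im
    simpa [hz₀] using hH0
  have hz₀x : dist z₀ (x : ℂ) = H := by
    rw [dist_eq_norm, hz₀, add_sub_cancel_left, norm_mul, Complex.norm_real, norm_I, mul_one,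
      Real.norm_eq_abs, abs_of_pos hH0]
  have hρH : ρ < dist z₀ (x : ℂ) := by rw [hz₀x, hH]; linarith
  have hax : dist a (x : ℂ) ≤ 1 + C₀ := mem_closedBall.1 (isClosed_closedBall.mem_of_tendsto ha
    (by filter_upwards [Ioo_mem_nhdsGT pi_pos] with t ht using hnear t ht))
  have hfar : η < dist (f z₀) a := by
    have h1 : dist (f z₀) z₀ ≤ C₀ := by rw [dist_eq_norm]; exact hC z₀ hz₀H
    have h2 : dist z₀ (x : ℂ) ≤ dist z₀ (f z₀) + dist (f z₀) a + dist a x :=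
      (dist_triangle z₀ (f z₀) x).trans (by linarith [dist_triangle (f z₀) a (x : ℂ)])
    rw [hz₀x, dist_comm z₀ (f z₀)] at h2
    rw [hH] at h2
    linarith
  have hR₃ : dist z₀ (x : ℂ) < H + 1 := by rw [hz₀x]; linarith
  have hbdd : IsBounded (f '' (upperHalfPlaneSet ∩ ball (x : ℂ) (H + 1))) := by
    refine (isBounded_closedBall (x := (x : ℂ)) (r := H + 1 + C₀)).subset ?_
    rintro _ ⟨w, ⟨hw, hwx⟩, rfl⟩
    rw [mem_closedBall]
    rw [mem_ball] at hwx
    have h1 : dist (f w) w ≤ C₀ := by rw [dist_eq_norm]; exact hC w hw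
    linarith [dist_triangle (f w) w (x : ℂ)]
  refine ⟨a, haU, fun w hw hwd ↦ ?_⟩
  exact forall_dist_le_of_crosscut_halfPlane hf.continuousOn hU hfU hgc hgU hgf hfg hρ0 ha hb
    hσc hσK hσU haσ hbσ (fun t ht ↦ (hda t ht).trans hη) hση hz₀H hρH hfar hR₃ hbdd w hw
    (hwd.trans hdρ)

end Modulus

end ConformalKit

/-- **Registered form** (anchor `conformalKit_exists_forall_dist_le_of_hlc` of stmt-CriticalPhenomena-0746, (K2)):
for a conformal bijection `f : ℍ → U` (open `U`, continuous inverse `g`, displacement `≤ C₀`), uniform local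
connectedness of `ℂ ∖ U` at scale `(ε₁, η)` on `V ⊇ B̄(x, 1 + C₀)` and a radius `0 < d < 1` with Wolff bound
`4π(1 + C₀)/√(log(1/d)) < ε₁`, `≤ η` give `f(ℍ ∩ B(x, d)) ⊆ B̄(a, η)` for some `a ∈ ∂U`. [cite: PommerenkeBBCM1992, Prop. 2.3] -/
theorem conformalKit_exists_forall_dist_le_of_hlc : ∀ (U V : Set ℂ) (f g : ℂ → ℂ) (C₀ ε₁ η d x : ℝ), DifferentiableOn ℂ f UpperHalfPlane.upperHalfPlaneSet → IsOpen U → Set.MapsTo f UpperHalfPlane.upperHalfPlaneSet U → ContinuousOn g U → Set.MapsTo g U UpperHalfPlane.upperHalfPlaneSet → (∀ w ∈ UpperHalfPlane.upperHalfPlaneSet, g (f w) = w) → (∀ z ∈ U, f (g z) = z) → 0 ≤ C₀ → (∀ w ∈ UpperHalfPlane.upperHalfPlaneSet, ‖f w - w‖ ≤ C₀) → (∀ a ∈ frontier U, ∀ b ∈ frontier U, a ∈ V → b ∈ V → dist a b < ε₁ → ∃ σ ⊆ Uᶜ, IsCompact σ ∧ IsPreconnected σ ∧ a ∈ σ ∧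 b ∈ σ ∧ σ ⊆ Metric.closedBall a η) → 0 < d → d < 1 → 4 * Real.pi * (1 + C₀) / Real.sqrt (Real.log (1 / d)) < ε₁ → 4 * Real.pi * (1 + C₀) / Real.sqrt (Real.log (1 / d)) ≤ η → Metric.closedBall (x : ℂ) (1 + C₀) ⊆ V → ∃ a ∈ frontier U, ∀ w ∈ UpperHalfPlane.upperHalfPlaneSet, dist w x < d → dist (f w) a ≤ η :=
  fun _ _ _ _ _ _ _ _ _ hf hU hfU hgc hgU hgf hfg hC₀ hC hlc hd hd1 hε₁ hη hV ↦
    ConformalKit.exists_forall_dist_le_of_hlc hf hU hfU hgc hgU hgf hfg hC₀ hC hlc hd hd1 hε₁ hη hV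

end Summit.CriticalPhenomena.CardyFormulaZ2.Cruxes.CardyRigidity.CrossingMartingale
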